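import Summits.ABC.ABC.Theses.CubicResolventAllowance
import Literature.NumberTheory.NumberFields.CubicFieldExplicit
import Literature.NumberTheory.EllipticCurves.SzpiroLocalDataProofs
import Literature.NumberTheory.EllipticCurves.QuadraticTwist
import Literature.NumberTheory.DiophantineGeometry.ValuationProductElliptic
import Literature.Barriers.ABC.SzpiroEpsilonCannotBeDropped

/-!
# Stub ideation k=3 (HOME = family 3: probe the extremes), gen 2 — `stub_complexCubic` of crux
`IndexSzpiro` (stmt-ABC-22740, route-ABC-CubicResolventAllowance)

Elaboration sanity for the helper statements named in `STUB-IDEAS-stub_complexCubic-3.md` (gen 2).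
Statements carry `sorry` bodies unless marked VERIFIED; nothing here is a tree proposal.
Namespace `…Cruxes.IndexSzpiro.StubIdeas3Complex` (the name `StubIdeas3` belongs to the realCubic k=3 seat).

* §0  the stub verbatim + shorthands (`IsResolventField`, `Ineq`).
* §A  gen-0 dictionary / allowance / rung statements H1–R1, re-typed here so that they live in the tree
      (gen-0's `Sketch.lean` was evidence-only).
* §D  NEW (gen 2): the single-field dictionary — inside ONE cubic field `K` the curves of the class are
      `y² = g_β(x)`, `β ∈ 𝓞_K` primitive, `Δ = 16·disc g_β = 16·I(β)²·d_K`; at every odd prime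
      `p ∤ d_K` dividing `I(β)` the model is a NODE (minimal, multiplicative, `f_p = 1`), so the stub
      restricted to one field is abc-quality `≤ 3+ε` for the values of ONE binary cubic (index) form.
* §E  NEW (gen 2): the extremal single-field configurations (Mordell–Weil orbits on the plane cubics
      `I_K(x,y) = h z³`, certified `ι → 6⁺`, jobs j344510/j344526) typed as NEGATIVE statements:
      `ε` cannot be dropped even with the 2-division field pinned to `d_K = -23`.
-/

open Polynomial

namespace Summit.ABC.ABC.Cruxes.IndexSzpiro.StubIdeas3Complex

open IsDedekindDomain Rat.HeightOneSpectrum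
open Literature.NumberTheory.NumberFields
open Literature.NumberTheory.DiophantineGeometry (mestreOesterle1989_thm_1)
open scoped NumberField

/-! ## §0 The stub, verbatim, and shorthands -/

/-- The registered stub `stub_complexCubic` (signature verbatim). -/
def Stub : Prop :=
  ∀ ε : ℝ, 0 < ε → ∃ C : ℝ, ∀ (W : WeierstrassCurve ℚ) [W.IsElliptic] (K : Type) [Field K]
    [NumberField K], Irreducible W.twoTorsionPolynomial.toPoly → Module.finrank ℚ K = 3 →
    (∃ θ : K, aeval θ W.twoTorsionPolynomial.toPoly = 0) → NumberField.discr K < 0 →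
    (W.minimalDiscriminantNorm ℤ : ℝ) ≤
      C * |(NumberField.discr K : ℝ)| * (W.conductorNorm ℤ : ℝ) ^ (6 + ε)

/-- `K` is "the" cubic field of `W`: irreducible 2-division cubic with a root in the cubic field `K`. -/
def IsResolventField (W : WeierstrassCurve ℚ) (K : Type) [Field K] [NumberField K] : Prop :=
  Irreducible W.twoTorsionPolynomial.toPoly ∧ Module.finrank ℚ K = 3 ∧
    ∃ θ : K, aeval θ W.twoTorsionPolynomial.toPoly = 0

/-- The stub's inequality with constant `C` and exponent `6 + ε`. -/
def Ineq (C ε : ℝ) (W : WeierstrassCurve ℚ) [W.IsElliptic] (K : Type) [Field K] [NumberField K] :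
    Prop :=
  (W.minimalDiscriminantNorm ℤ : ℝ) ≤ C * |(NumberField.discr K : ℝ)| * (W.conductorNorm ℤ : ℝ) ^ (6 + ε)

/-- Sanity (VERIFIED): the stub in shorthand. -/
theorem stub_iff : Stub ↔ ∀ ε : ℝ, 0 < ε → ∃ C : ℝ, ∀ (W : WeierstrassCurve ℚ) [W.IsElliptic]
    (K : Type) [Field K] [NumberField K], IsResolventField W K → NumberField.discr K < 0 →
    Ineq C ε W K := by
  constructor
  · intro h ε hε
    obtain ⟨C, hC⟩ := h ε hε
    exact ⟨C, fun W _ K _ _ hR hd => hC W K hR.1 hR.2.1 hR.2.2 hd⟩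
  · intro h ε hε
    obtain ⟨C, hC⟩ := h ε hε
    exact ⟨C, fun W _ K _ _ h1 h2 h3 hd => hC W K ⟨h1, h2, h3⟩ hd⟩

/-! ## §A gen-0 statements (dictionary of the extremal configuration; allowance; rungs) -/

/-- **H1 `DiscSqRatio` (M).** `Δ(W) = q²·d_K`, `q ∈ ℚˣ` (power basis of a root vs integral basis;
`WeierstrassCurve.twoTorsionPolynomial_discr`, `Algebra.discr_powerBasis_eq_norm`). -/
def DiscSqRatio : Prop :=
  ∀ (W : WeierstrassCurve ℚ) [W.IsElliptic] (K : Type) [Field K] [NumberField K],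
    IsResolventField W K → ∃ q : ℚ, q ≠ 0 ∧ W.Δ = q ^ 2 * (NumberField.discr K : ℚ)

/-- **H2 `ComplexIffNegDelta` (S from H1).** -/
def ComplexIffNegDelta : Prop :=
  ∀ (W : WeierstrassCurve ℚ) [W.IsElliptic] (K : Type) [Field K] [NumberField K],
    IsResolventField W K → (NumberField.discr K < 0 ↔ W.Δ < 0)

/-- VERIFIED: H1 ⇒ H2. -/
theorem complexIffNegDelta_of_discSqRatio (h : DiscSqRatio) : ComplexIffNegDelta := by
  intro W _ K _ _ hR
  obtain ⟨q, hq, hΔ⟩ := h W K hR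
  have hq2 : (0 : ℚ) < q ^ 2 := by positivity
  constructor
  · intro hd
    rw [hΔ]
    exact mul_neg_of_pos_of_neg hq2 (by exact_mod_cast hd)
  · intro hΔ0
    rw [hΔ] at hΔ0
    have : (NumberField.discr K : ℚ) < 0 := by
      by_contra hc
      push_neg at hc
      exact absurd hΔ0 (not_lt.mpr (mul_nonneg hq2.le hc))
    exact_mod_cast this

/-- **H2′ `JLeOfComplex` (S).** complex class ⇒ `j ≤ 1728` (`j - 1728 = c₆²/Δ`, `Δ < 0`). -/
def JLeOfComplex : Prop :=
  ∀ (W : WeierstrassCurve ℚ) [W.IsElliptic] (K : Type) [Field K] [NumberField K],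
    IsResolventField W K → NumberField.discr K < 0 → W.j ≤ 1728

/-- **H3 `TowerPrimeHasLocalRoot` (M/L).** a tower prime (`ord_p j < 0`) is never inert in `K`:
the Tate parametrisation gives a `ℚ_p`-rational root of the 2-division cubic. -/
def TowerPrimeHasLocalRoot : Prop :=
  ∀ (W : WeierstrassCurve ℚ) [W.IsElliptic] (p : ℕ) [Fact p.Prime], padicValRat p W.j < 0 →
    ∃ θ : ℚ_[p], aeval θ W.twoTorsionPolynomial.toPoly = 0

/-- **H4 `OddTowerDvdDiscr` (M, the allowance lemma).** odd tower at an odd prime ⇒ `p ∣ d_K`. -/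
def OddTowerDvdDiscr : Prop :=
  ∀ (W : WeierstrassCurve ℚ) [W.IsElliptic] (K : Type) [Field K] [NumberField K] (p : ℕ)
    [Fact p.Prime], IsResolventField W K → p ≠ 2 → padicValRat p W.j < 0 →
    Odd (padicValRat p W.j).natAbs → (p : ℤ) ∣ NumberField.discr K

/-- **H4′ `DiscrSupportSemistable` (M).** on the semistable class the odd part of `d_K` is exactly the
set of odd primes with an odd tower. -/
def DiscrSupportSemistable : Prop :=
  ∀ (W : WeierstrassCurve ℚ) [W.IsElliptic] (K : Type) [Field K] [NumberField K] (p : ℕ)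
    [Fact p.Prime], IsResolventField W K → Squarefree (W.conductorNorm ℤ) → p ≠ 2 →
    (p : ℤ) ∣ NumberField.discr K → padicValRat p W.j < 0 ∧ Odd (padicValRat p W.j).natAbs

/-- **H5 `TwistClosure` (M).** quadratic twists by `d ≡ 1 (4)` coprime to the additive primes keep `K`
and cost an absolute factor. -/
def TwistClosure : Prop :=
  ∃ c₀ : ℝ, 0 < c₀ ∧ ∀ (C ε : ℝ) (W : WeierstrassCurve ℚ) [W.IsElliptic] (K : Type) [Field K]
    [NumberField K] (d : ℤ), 0 < ε → Squarefree d → d % 4 = 1 →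
    (∀ p : ℕ, p.Prime → (p : ℤ) ∣ d → ¬ p ^ 2 ∣ W.conductorNorm ℤ) →
    ∀ [(W.quadraticTwist (d : ℚ)).IsElliptic], Ineq C ε W K → Ineq (c₀ * C) ε (W.quadraticTwist (d : ℚ)) K

/-- **H6 `PrimeConductorTwistRung` (S/M, rung mod Mestre–Oesterlé, both signs).** -/
def PrimeConductorTwistRung : Prop :=
  mestreOesterle1989_thm_1 → ∀ ε : ℝ, 0 < ε → ∀ (W : WeierstrassCurve ℚ) [W.IsElliptic] (K : Type)
    [Field K] [NumberField K] (d : ℤ), (W.conductorNorm ℤ).Prime → Squarefree d → d % 4 = 1 →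
    IsResolventField W K → ∀ [(W.quadraticTwist (d : ℚ)).IsElliptic],
    Ineq (2 ^ 24) ε (W.quadraticTwist (d : ℚ)) K

/-- **R1 `SemistableLowTowerRung` (S/M).** semistable, all towers `≤ 7` ⇒ the stub inequality with
`C = 2` (towers `≤ 6` free; a tower `7` at odd `p` pays `p ∣ d_K` by H4). -/
def SemistableLowTowerRung : Prop :=
  ∀ ε : ℝ, 0 < ε → ∀ (W : WeierstrassCurve ℚ) [W.IsElliptic] (K : Type) [Field K] [NumberField K],
    IsResolventField W K → Squarefree (W.conductorNorm ℤ) →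
    (∀ p : ℕ, p.Prime → -8 < padicValRat p W.j) → Ineq 2 ε W K

/-! ## §D NEW — the single-field dictionary (node primes) -/

/-- The model `y² = x³ + a x² + b x + c` over `ℤ`. -/
def cubicModel (a b c : ℤ) : WeierstrassCurve ℤ := ⟨0, a, 0, b, c⟩

/-- VERIFIED: `c₄ = 16 (a² - 3b)`. -/
theorem cubicModel_c₄ (a b c : ℤ) : (cubicModel a b c).c₄ = 16 * (a ^ 2 - 3 * b) := by
  simp only [cubicModel, WeierstrassCurve.c₄, WeierstrassCurve.b₂, WeierstrassCurve.b₄]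
  ring

/-- VERIFIED: `Δ = 16 · disc(x³ + a x² + b x + c)`. -/
theorem cubicModel_Δ (a b c : ℤ) : (cubicModel a b c).Δ = 16 * MonicCubic.disc a b c := by
  simp only [cubicModel, WeierstrassCurve.Δ, WeierstrassCurve.b₂, WeierstrassCurve.b₄,
    WeierstrassCurve.b₆, WeierstrassCurve.b₈, MonicCubic.disc]
  ring

/-- VERIFIED: the 2-division cubic of the model is `⟨4, 4a, 4b, 4c⟩`. -/
theorem cubicModel_twoTorsionPolynomial (a b c : ℤ) :
    ((cubicModel a b c).baseChange ℚ).twoTorsionPolynomial = ⟨4, 4 * a, 4 * b, 4 * c⟩ := by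
  simp only [cubicModel, WeierstrassCurve.baseChange, WeierstrassCurve.map,
    WeierstrassCurve.twoTorsionPolynomial, WeierstrassCurve.b₂, WeierstrassCurve.b₄,
    WeierstrassCurve.b₆, map_zero, eq_intCast]
  ext <;> ring

/-- VERIFIED: … i.e. `4 · (x³ + a x² + b x + c)` as a polynomial. -/
theorem cubicModel_twoTorsionPolynomial_toPoly (a b c : ℤ) :
    ((cubicModel a b c).baseChange ℚ).twoTorsionPolynomial.toPoly = C (4 : ℚ) * MonicCubic.polyQ a b c := by
  rw [cubicModel_twoTorsionPolynomial, MonicCubic.polyQ_eq]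
  simp only [Cubic.toPoly, map_mul, map_intCast]
  ring

/-- `θ ∈ 𝓞_K` is primitive at `p`: `θ ∉ ℤ + p𝓞_K`. For `𝓞_K = ℤ[α]`, `θ = m + bα + cα²` this is
`p ∤ gcd(b, c)`. -/
def PrimitiveAt (K : Type) [Field K] [NumberField K] (θ : 𝓞 K) (p : ℕ) : Prop :=
  ∀ m : ℤ, ¬ ((p : 𝓞 K) ∣ θ - m)

/-- **D2 `NoTripleRootOfPrimitive` (M, NEW).** If `θ ∈ 𝓞_K` is a root of `g = x³ + a x² + b x + c`,
`p` is an odd prime UNRAMIFIED in `K` and `θ` is primitive at `p`, then `g` has no triple root mod `p`: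
`¬ (p ∣ disc g ∧ p ∣ a² - 3b)`. Proof: a triple root `t` gives `(θ - t)³ ∈ p𝓞_K`; `p𝓞_K` is radical
(`e = 1` everywhere, tree `not_dvd_discr_iff_forall_ramificationIdx_eq_one`), so `θ ≡ t (mod p𝓞_K)`.
For `p = 3`: triple root ⟺ `3 ∣ a ∧ 3 ∣ b` ⟺ `3 ∣ disc ∧ 3 ∣ a² - 3b`, same conclusion. -/
theorem noTripleRoot_of_primitive (K : Type) [Field K] [NumberField K] (a b c : ℤ) (θ : 𝓞 K)
    (hroot : aeval (θ : K) (MonicCubic.polyQ a b c) = 0) {p : ℕ} (hp : p.Prime) (hp2 : p ≠ 2)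
    (hunr : ¬ (p : ℤ) ∣ NumberField.discr K) (hprim : PrimitiveAt K θ p)
    (hdisc : (p : ℤ) ∣ MonicCubic.disc a b c) : ¬ (p : ℤ) ∣ a ^ 2 - 3 * b := by
  sorry

/-- **D3 `NodePrime` (S, NEW; tree glue).** At an odd prime dividing `disc g` but not `a² - 3b` the model
`y² = g(x)` is minimal with multiplicative reduction, `f_p = 1`
(`isMinimalAt_baseChange_int_of_not_dvd_c₄`, `conductorExponent_eq_one_of_dvd_Δ_of_not_dvd_c₄`, D0). -/
theorem nodePrime (a b c : ℤ) [((cubicModel a b c).baseChange ℚ).IsElliptic]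
    (v : HeightOneSpectrum ℤ) (hodd : natGenerator v ≠ 2)
    (hΔ : (natGenerator v : ℤ) ∣ MonicCubic.disc a b c) (hc : ¬ (natGenerator v : ℤ) ∣ a ^ 2 - 3 * b) :
    ((cubicModel a b c).baseChange ℚ).IsMinimalAt v ∧
      ((cubicModel a b c).baseChange ℚ).conductorExponent v = 1 := by
  have hc₄ : ¬ (natGenerator v : ℤ) ∣ (cubicModel a b c).c₄ := by
    -- VERIFIED: `c₄ = 16 (a² - 3b)` (D0) and `p` odd prime
    rw [cubicModel_c₄]
    intro h
    have hp : (natGenerator v).Prime := (primesEquiv v).2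
    have hpZ : Prime (natGenerator v : ℤ) := Int.prime_iff_natAbs_prime.mpr (by simpa using hp)
    rcases hpZ.dvd_or_dvd h with h16 | h3
    · have h2 : (natGenerator v : ℤ) ∣ 2 ^ 4 := by norm_num at h16 ⊢; exact h16
      have h2' := hpZ.dvd_of_dvd_pow h2
      have : (natGenerator v : ℤ) ≤ 2 := Int.le_of_dvd (by norm_num) h2'
      have h1 : 2 ≤ natGenerator v := hp.two_le
      omega
    · exact hc h3
  have hmin := WeierstrassCurve.isMinimalAt_baseChange_int_of_not_dvd_c₄ hc₄
  refine ⟨hmin, WeierstrassCurve.conductorExponent_eq_one_of_dvd_Δ_of_not_dvd_c₄ hmin ?_ hc₄⟩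
  rw [cubicModel_Δ]
  exact Dvd.dvd.mul_left hΔ 16

/-- **D4 `ConductorSupport` (M, NEW).** For `θ` primitive at every odd unramified prime, the conductor of
`y² = g_θ(x)` divides `2⁸ · 3⁵ · d_K² · rad(disc g_θ)`: additive primes are `2`, `3` or ramified in `K`
(D2 + D3 + `f_p ≤ 2` for `p ≥ 5`, `f_3 ≤ 5`, `f_2 ≤ 8`; `conductorNorm_dvd_of_forall_conductorExponent_le`). -/
theorem conductorSupport (K : Type) [Field K] [NumberField K] (a b c : ℤ) (θ : 𝓞 K)
    (hroot : aeval (θ : K) (MonicCubic.polyQ a b c) = 0)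
    (hprim : ∀ p : ℕ, p.Prime → p ≠ 2 → ¬ (p : ℤ) ∣ NumberField.discr K → PrimitiveAt K θ p)
    [((cubicModel a b c).baseChange ℚ).IsElliptic] :
    ((cubicModel a b c).baseChange ℚ).conductorNorm ℤ ∣
      2 ^ 8 * 3 ^ 5 * (NumberField.discr K).natAbs ^ 2 *
        UniqueFactorizationMonoid.radical (MonicCubic.disc a b c).natAbs := by
  sorry

/-- `(a,b,c)` is a primitive `K`-rooted cubic: `g` irreducible with a root `θ ∈ 𝓞_K` primitive at every
odd prime unramified in `K`. Inside one field these are (up to `x ↦ x + m`) the points of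
`X_K(2)(ℚ) ≅ ℙ¹(ℚ)`: `θ = b·ω₂ + c·ω₃`, `gcd(b,c)` supported on `2·d_K`. -/
def PrimRooted (K : Type) [Field K] [NumberField K] (a b c : ℤ) : Prop :=
  Irreducible (MonicCubic.polyQ a b c) ∧ ∃ θ : 𝓞 K, aeval (θ : K) (MonicCubic.polyQ a b c) = 0 ∧
    ∀ p : ℕ, p.Prime → p ≠ 2 → ¬ (p : ℤ) ∣ NumberField.discr K → PrimitiveAt K θ p

/-- The stub restricted to ONE field `K` and to the models `y² = g(x)`, `g` primitive `K`-rooted. -/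
def StubPrimOn (K : Type) [Field K] [NumberField K] : Prop :=
  ∀ ε : ℝ, 0 < ε → ∃ C : ℝ, ∀ a b c : ℤ, PrimRooted K a b c →
    ∀ [((cubicModel a b c).baseChange ℚ).IsElliptic], Ineq C ε ((cubicModel a b c).baseChange ℚ) K

/-- **`IndexFormABC K`** — abc-quality `≤ 6+ε` for the discriminants (= `I(θ)²·d_K`) of primitive
`K`-rooted cubics, i.e. quality `≤ 3+ε/2` for the values of the INDEX FORM of `K` at primitive points. -/
def IndexFormABC (K : Type) [Field K] [NumberField K] : Prop :=
  ∀ ε : ℝ, 0 < ε → ∃ C : ℝ, ∀ a b c : ℤ, PrimRooted K a b c →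
    ((MonicCubic.disc a b c).natAbs : ℝ) ≤
      C * (UniqueFactorizationMonoid.radical (MonicCubic.disc a b c).natAbs : ℝ) ^ (6 + ε)

/-- VERIFIED: the stub specialises to every complex cubic field. -/
theorem stubPrimOn_of_stub (h : Stub) (K : Type) [Field K] [NumberField K]
    (h3 : Module.finrank ℚ K = 3) (hd : NumberField.discr K < 0) : StubPrimOn K := by
  intro ε hε
  obtain ⟨C₀, hC⟩ := h ε hε
  refine ⟨C₀, fun a b c hP _ => ?_⟩
  obtain ⟨hirr, θ, hθ, -⟩ := hP
  have hirr' : Irreducible ((cubicModel a b c).baseChange ℚ).twoTorsionPolynomial.toPoly := by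
    rw [cubicModel_twoTorsionPolynomial_toPoly]
    have hu : IsUnit (C (4 : ℚ)) := Polynomial.isUnit_C.mpr (by norm_num)
    exact (irreducible_isUnit_mul hu).mpr hirr
  have hθ' : ∃ θ' : K, aeval θ' ((cubicModel a b c).baseChange ℚ).twoTorsionPolynomial.toPoly = 0 :=
    ⟨θ, by rw [cubicModel_twoTorsionPolynomial_toPoly, map_mul, hθ, mul_zero]⟩
  exact hC _ K hirr' h3 hθ' hd

/-- **D5 (M, NEW).** `IndexFormABC K ⇒ StubPrimOn K`: `Δ_min ≤ |Δ(model)| = 16·|disc g|` and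
`rad(disc g) ∣ 6·rad(d_K)·N` (every `p ∣ disc g`, `p ∤ 6 d_K`, is a node prime of `N` by D2/D3). -/
theorem stubPrimOn_of_indexFormABC (K : Type) [Field K] [NumberField K] (h : IndexFormABC K) :
    StubPrimOn K := by
  sorry

/-- **D5′ (M, NEW, converse on the part prime to `6 d_K`).** `StubPrimOn K ⇒` abc-quality `≤ 6+ε` for the
prime-to-`6d_K` part of `disc g` (minimality at node primes, D3, and `N ∣ 2⁸3⁵d_K²·rad(disc g)`, D4). -/
theorem indexFormABC_coprime_of_stubPrimOn (K : Type) [Field K] [NumberField K] (h : StubPrimOn K) :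
    ∀ ε : ℝ, 0 < ε → ∃ C : ℝ, ∀ a b c : ℤ, PrimRooted K a b c →
      ∀ [((cubicModel a b c).baseChange ℚ).IsElliptic],
      (((MonicCubic.disc a b c).natAbs / Nat.gcd (MonicCubic.disc a b c).natAbs
          ((6 * (NumberField.discr K).natAbs) ^ ((MonicCubic.disc a b c).natAbs)) : ℕ) : ℝ) ≤
        C * (UniqueFactorizationMonoid.radical (MonicCubic.disc a b c).natAbs : ℝ) ^ (6 + ε) := by
  sorry

/-! ## §E NEW — extremal configurations typed as negative statements (ε cannot be dropped in-class) -/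

/-- `ε = 0` with constant `C` on the class of `K`'s of discriminant `d`. -/
def EpsZeroOn (d : ℤ) (C : ℝ) : Prop :=
  ∀ (W : WeierstrassCurve ℚ) [W.IsElliptic] (K : Type) [Field K] [NumberField K],
    IsResolventField W K → NumberField.discr K = d →
    (W.minimalDiscriminantNorm ℤ : ℝ) ≤ C * |(d : ℝ)| * (W.conductorNorm ℤ : ℝ) ^ (6 : ℝ)

/-- **E1 `EpsNecessaryOnField23` (conjectured TRUE, mechanism certified numerically, NEW).** Even with
the 2-division field pinned to the complex cubic field of discriminant `-23`, no constant works at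
`ε = 0`: along the Mordell–Weil orbit `n·P` on `x³ - x y² - y³ = z³` the `23`-adic valuation of
`z(nP)` is unbounded on `n ≡ 5 (23), 28 (23²), …` (formal group), each step multiplying
`Δ_min/(|d_K| N⁶)` by `23⁶`; certified instance `n = 28`: `Δ_min > 10^{3.95}·23·N⁶` (j344510).
In-class analogue of `Literature.Barriers.ABC.SzpiroEpsilonCannotBeDropped`; nearest print:
Bennett–Yazdani 2012 §7 (`X_F(6)`-twist families, `E[2]` fixed). -/
def EpsNecessaryOnField23 : Prop := ∀ C : ℝ, ¬ EpsZeroOn (-23) C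

/-- **E2 (conjectured TRUE, NEW).** The same inside EVERY cubic field (real or complex): the index-form
plane cubic `I_K(x,y) = z³` always has the rational points `(1:0:1)`, `(0:1:*)`…; whenever one of the
curves `I_K = h z³` has positive rank the orbit gives `ι → 6` with unbounded `Δ_min/(|d_K|N⁶)`. -/
def EpsNecessaryOnEveryCubicField : Prop :=
  ∀ (d : ℤ) (C : ℝ), (∃ (K : Type) (_ : Field K) (_ : NumberField K),
    Module.finrank ℚ K = 3 ∧ NumberField.discr K = d) → ¬ EpsZeroOn d C

/-- VERIFIED bookkeeping: E1 is the `d = -23` instance of E2's conclusion shape, and the global barrier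
`not_szpiro_epsilon_zero` does NOT imply E1 (it may use curves from other classes) — E1 is stronger
information about where the stub's `ε` is spent. -/
theorem epsNecessaryOnField23_of_every (h : EpsNecessaryOnEveryCubicField)
    (hK : ∃ (K : Type) (_ : Field K) (_ : NumberField K), Module.finrank ℚ K = 3 ∧ NumberField.discr K = -23) :
    EpsNecessaryOnField23 := fun C => h (-23) C hK

end Summit.ABC.ABC.Cruxes.IndexSzpiro.StubIdeas3Complex
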